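import Summits.QuantumAdvantage.AdviceFreeQNC0.AffBells33StairContraction

/-!
# AffBells33 (planner qa-qnc0-p2 g33) — line L3 staircase toolkit, part 3: chains, stage words, geometric bounds (§6)

Continuation of `AffBells33StairOps` / `AffBells33StairContraction`: shifts and isometries of `ℓ¹`, untwisted stage words
(`applyU_le`: `(1/2)^{⌊n/3⌋}`) and twisted stage words (`applyT_le`: `2^Z (3/4)^{⌊(Z−1)/2⌋}`), W-S2b/W-S3b of
`HOME/qa-qnc0-p2/line33/PROOF-STAIR.md` §8.
Ported to the tree verbatim (split into three files `AffBells33StairOps` §1–§3 / `AffBells33StairContraction` §4–§5 /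
`AffBells33StairChains` §6 for the 400-line rule) by the prover seat qn-prover-3 g20 (landing ask of qa-qnc0-p2 g33, 11:0xZ);
authored and kernel-checked by the planner seat qa-qnc0-p2 g33 (`HOME/qa-qnc0-p2/line33/Sketch33.lean`, 672 l., rc 0 / 0 sorry).
WHAT THIS IS NOT: no crux; THEOREM S (`StaircaseLoss3`) is not proved here (W-S1/W-S4/W-S5 remain).
-/

namespace Summit.QuantumAdvantage.AdviceFreeQNC0

open Finset Literature.Computability.QuantumComplexity Literature.Computability.QuantumComplexity.RingHLF

namespace AffBells33

/-! ## 6. Chains (W-S2b/W-S3b, PROVED): shifts, isometries, stage words and the geometric bounds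

Emission blocks are `± S^a R_r` or `± S^a`; signs are irrelevant (`l1R_neg`, linearity), shifts are `ℓ¹`-isometries that fold into
coin blocks (`shiftL_circL`) and into twisted coins (`gtwL`).  An UNTWISTED STAGE is `R_r S^t Q` (coin block, shift, reflection); a
TWISTED STAGE is `G_{s,t} E` (optional reflection, then a shifted twisted coin).  `applyU` / `applyT` apply a list of stages head first. -/

/-- Shift `S^t`: `(S^t v)(h) = v(h − t)`. -/
noncomputable def shiftL (t : ZMod 3) : (ZMod 3 → ℝ) →ₗ[ℝ] (ZMod 3 → ℝ) where
  toFun v := fun h => v (h - t)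
  map_add' v w := by funext h; simp only [Pi.add_apply]
  map_smul' c v := by funext h; simp only [Pi.smul_apply, smul_eq_mul, RingHom.id_apply]

/-- Shifted twisted coin `S^s − S^t` (twice `S^s P⁻_{t−s}`). -/
noncomputable def gtwL (s t : ZMod 3) : (ZMod 3 → ℝ) →ₗ[ℝ] (ZMod 3 → ℝ) where
  toFun v := fun h => v (h - s) - v (h - t)
  map_add' v w := by funext h; simp only [Pi.add_apply]; ring
  map_smul' c v := by funext h; simp only [Pi.smul_apply, smul_eq_mul, RingHom.id_apply]; ring

/-- `l1R` is invariant under negation. -/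
theorem l1R_neg (v : ZMod 3 → ℝ) : l1R (-v) = l1R v := by simp [l1R, abs_neg]

/-- Reflections are `ℓ¹` isometries. -/
theorem l1R_reflL (r : ZMod 3) (v : ZMod 3 → ℝ) : l1R (reflL r v) = l1R v := by
  simp only [l1R, reflL, LinearMap.coe_mk, AddHom.coe_mk]
  split_ifs <;> simp only [abs_neg]

/-- Optional reflections are `ℓ¹` isometries. -/
theorem l1R_oreflL (o : Option (ZMod 3)) (v : ZMod 3 → ℝ) : l1R (oreflL o v) = l1R v := by
  cases o with
  | none => rfl
  | some r => exact l1R_reflL r v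

/-- Shifts are `ℓ¹` isometries. -/
theorem l1R_shiftL (t : ZMod 3) (v : ZMod 3 → ℝ) : l1R (shiftL t v) = l1R v := by
  obtain ⟨e1, e2, e3, f1, f2, f3⟩ := zmod3_subs
  rcases zmod3_cases t with rfl | rfl | rfl
  · simp only [l1R, shiftL, LinearMap.coe_mk, AddHom.coe_mk, sub_zero]
  · simp only [l1R, shiftL, LinearMap.coe_mk, AddHom.coe_mk, e1, e2, e3]; ring
  · simp only [l1R, shiftL, LinearMap.coe_mk, AddHom.coe_mk, f1, f2, f3]; ring

/-- Shifts preserve the total mass. -/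
theorem msum_shiftL (t : ZMod 3) (v : ZMod 3 → ℝ) : msum (shiftL t v) = msum v := by
  obtain ⟨e1, e2, e3, f1, f2, f3⟩ := zmod3_subs
  rcases zmod3_cases t with rfl | rfl | rfl
  · simp only [msum, shiftL, LinearMap.coe_mk, AddHom.coe_mk, sub_zero]
  · simp only [msum, shiftL, LinearMap.coe_mk, AddHom.coe_mk, e1, e2, e3]; ring
  · simp only [msum, shiftL, LinearMap.coe_mk, AddHom.coe_mk, f1, f2, f3]; ring

/-- A generalised twisted coin is a difference of two shifts. -/
theorem gtwL_eq_sub (s t : ZMod 3) (v : ZMod 3 → ℝ) : gtwL s t v = shiftL s v - shiftL t v := by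
  funext h; rfl

/-- Shifted twisted coins kill the total mass. -/
theorem msum_gtwL (s t : ZMod 3) (v : ZMod 3 → ℝ) : msum (gtwL s t v) = 0 := by
  have h1 := msum_shiftL s v; have h2 := msum_shiftL t v
  rw [gtwL_eq_sub]
  simp only [msum, Pi.sub_apply] at *
  linarith

/-- A generalised twisted coin at most doubles the `ℓ¹` norm. -/
theorem l1R_gtwL_le (s t : ZMod 3) (v : ZMod 3 → ℝ) : l1R (gtwL s t v) ≤ 2 * l1R v := by
  rw [gtwL_eq_sub, sub_eq_add_neg]
  refine (l1R_add_le _ _).trans ?_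
  rw [l1R_neg, l1R_shiftL, l1R_shiftL]; linarith

/-- A coin block is an `ℓ¹` contraction (stochastic circulant). -/
theorem l1R_circL_le {q : ZMod 3 → ℝ} (hq : IsCoinBlock q) (v : ZMod 3 → ℝ) : l1R (circL q v) ≤ l1R v := by
  obtain ⟨e1, e2, e3, f1, f2, f3⟩ := zmod3_subs
  obtain ⟨hq0, hq1, -⟩ := hq
  have a0 := hq0 0; have a1 := hq0 1; have a2 := hq0 2
  simp only [l1R, circL, LinearMap.coe_mk, AddHom.coe_mk, sub_zero, e1, e2, e3, f1, f2, f3]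
  have tri : ∀ x y z : ℝ, |q 0 * x + q 1 * y + q 2 * z| ≤ q 0 * |x| + q 1 * |y| + q 2 * |z| := by
    intro x y z
    have e1 := abs_add_le (q 0 * x + q 1 * y) (q 2 * z)
    have e2 := abs_add_le (q 0 * x) (q 1 * y)
    rw [abs_mul, abs_of_nonneg a2] at e1
    rw [abs_mul, abs_mul, abs_of_nonneg a0, abs_of_nonneg a1] at e2
    linarith
  have t0 := tri (v 0) (v 2) (v 1)
  have t1 := tri (v 1) (v 0) (v 2)
  have t2 := tri (v 2) (v 1) (v 0)
  have hsum : q 0 * |v 0| + q 1 * |v 2| + q 2 * |v 1| + (q 0 * |v 1| + q 1 * |v 0| + q 2 * |v 2|)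
      + (q 0 * |v 2| + q 1 * |v 1| + q 2 * |v 0|) = (q 0 + q 1 + q 2) * (|v 0| + |v 1| + |v 2|) := by ring
  rw [hq1, one_mul] at hsum
  linarith

/-- Shifts fold into coin blocks … -/
theorem shiftL_circL (t : ZMod 3) (q : ZMod 3 → ℝ) (v : ZMod 3 → ℝ) :
    shiftL t (circL q v) = circL (fun a => q (a - t)) v := by
  obtain ⟨e1, e2, e3, f1, f2, f3⟩ := zmod3_subs
  have g11 : (1 : ZMod 3) + 1 = 2 := by decide
  have g12 : (1 : ZMod 3) + 2 = 0 := by decide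
  have g21 : (2 : ZMod 3) + 1 = 0 := by decide
  have g22 : (2 : ZMod 3) + 2 = 1 := by decide
  funext h
  rcases zmod3_cases t with rfl | rfl | rfl
  · simp only [shiftL, circL, LinearMap.coe_mk, AddHom.coe_mk, sub_zero]
  · simp only [shiftL, circL, LinearMap.coe_mk, AddHom.coe_mk, sub_zero, sub_sub, e1, e2, e3, g11, g12]; ring
  · simp only [shiftL, circL, LinearMap.coe_mk, AddHom.coe_mk, sub_zero, sub_sub, f1, f2, f3, g21, g22]; ring

/-- … and preserve the coin-block class. -/
theorem IsCoinBlock.shift {q : ZMod 3 → ℝ} (hq : IsCoinBlock q) (t : ZMod 3) : IsCoinBlock (fun a => q (a - t)) := by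
  obtain ⟨e1, e2, e3, f1, f2, f3⟩ := zmod3_subs
  obtain ⟨hq0, hq1, hq2⟩ := hq
  refine ⟨fun a => hq0 _, ?_, fun a => hq2 _⟩
  rcases zmod3_cases t with rfl | rfl | rfl
  · simp only [sub_zero]; exact hq1
  · simp only [e1, e2, e3]; linarith
  · simp only [f1, f2, f3]; linarith

/-- `gtwL` on integer vectors is `gtw`. -/
theorem gtwL_castV (s t : ZMod 3) (v : ZMod 3 → ℤ) : gtwL s t (castV v) = castV (gtw s t v) := by
  funext h
  simp only [gtwL, LinearMap.coe_mk, AddHom.coe_mk, castV, gtw]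
  push_cast; ring

/-- LEMMA C⁻ with shifted twisted coins on the basis differences (from the integer certificate). -/
theorem gtwWord_diff_le {i j : ZMod 3} (hij : i ≠ j) (o₀ o₁ : Option (ZMod 3)) {s₁ t₁ s₂ t₂ : ZMod 3}
    (h₁ : s₁ ≠ t₁) (h₂ : s₂ ≠ t₂) :
    l1R (gtwL s₂ t₂ (oreflL o₁ (gtwL s₁ t₁ (oreflL o₀ (castV (dZ i j)))))) ≤ 6 := by
  rw [oreflL_castV, gtwL_castV, oreflL_castV, gtwL_castV, l1R_castV]
  exact_mod_cast gtwTwoCoinContractionZ i j hij o₀ o₁ s₁ t₁ s₂ t₂ h₁ h₂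

/-- **LEMMA C⁻ over ℝ with shifted twisted coins (PROVED)**: `‖G₂ E₁ G₁ E₀ v‖₁ ≤ 3‖v‖₁` for mean-zero `v`. -/
theorem gtwTwoCoinContraction (o₀ o₁ : Option (ZMod 3)) {s₁ t₁ s₂ t₂ : ZMod 3} (h₁ : s₁ ≠ t₁) (h₂ : s₂ ≠ t₂)
    (v : ZMod 3 → ℝ) (hv : msum v = 0) :
    l1R (gtwL s₂ t₂ (oreflL o₁ (gtwL s₁ t₁ (oreflL o₀ v)))) ≤ 3 * l1R v := by
  set W : (ZMod 3 → ℝ) →ₗ[ℝ] (ZMod 3 → ℝ) := (gtwL s₂ t₂) ∘ₗ (oreflL o₁) ∘ₗ (gtwL s₁ t₁) ∘ₗ (oreflL o₀) with hWdef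
  have hWap : ∀ w, gtwL s₂ t₂ (oreflL o₁ (gtwL s₁ t₁ (oreflL o₀ w))) = W w := fun w => rfl
  have hW : ∀ i j : ZMod 3, i ≠ j → l1R (W (castV (dZ i j))) ≤ 6 := fun i j hij => by
    rw [← hWap]; exact gtwWord_diff_le hij o₀ o₁ h₁ h₂
  rw [hWap]
  have hv2 : v 2 = -v 0 - v 1 := by unfold msum at hv; linarith
  obtain ⟨n02, n20, n12, n21, n01, n10⟩ := zmod3_ne
  have dec01 : v = v 0 • castV (dZ 0 2) + v 1 • castV (dZ 1 2) := by
    funext h; rcases zmod3_cases h with rfl | rfl | rfl <;> simp [castV, dZ, δ, n02, n20, n12, n21, n01, n10]; linarith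
  have dec02 : v = v 0 • castV (dZ 0 1) + v 2 • castV (dZ 2 1) := by
    funext h; rcases zmod3_cases h with rfl | rfl | rfl <;> simp [castV, dZ, δ, n02, n20, n12, n21, n01, n10]; linarith
  have dec12 : v = v 1 • castV (dZ 1 0) + v 2 • castV (dZ 2 0) := by
    funext h; rcases zmod3_cases h with rfl | rfl | rfl <;> simp [castV, dZ, δ, n02, n20, n12, n21, n01, n10]; linarith
  have hl1 : l1R v = |v 0| + |v 1| + |v 2| := rfl
  rcases le_total 0 (v 0) with h0 | h0 <;> rcases le_total 0 (v 1) with h1 | h1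
  · refine twisted_aux W hW v 0 1 2 (by decide) (by decide) dec01 ?_
    rw [hl1, hv2, abs_of_nonneg h0, abs_of_nonneg h1, show -v 0 - v 1 = -(v 0 + v 1) by ring, abs_neg,
      abs_of_nonneg (by linarith : 0 ≤ v 0 + v 1)]; linarith
  · rcases le_total 0 (v 2) with h2 | h2
    · refine twisted_aux W hW v 0 2 1 (by decide) (by decide) dec02 ?_
      rw [hl1, abs_of_nonneg h0, abs_of_nonpos h1, abs_of_nonneg h2]; linarith
    · refine twisted_aux W hW v 1 2 0 (by decide) (by decide) dec12 ?_
      rw [hl1, abs_of_nonneg h0, abs_of_nonpos h1, abs_of_nonpos h2]; linarith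
  · rcases le_total 0 (v 2) with h2 | h2
    · refine twisted_aux W hW v 1 2 0 (by decide) (by decide) dec12 ?_
      rw [hl1, abs_of_nonpos h0, abs_of_nonneg h1, abs_of_nonneg h2]; linarith
    · refine twisted_aux W hW v 0 2 1 (by decide) (by decide) dec02 ?_
      rw [hl1, abs_of_nonpos h0, abs_of_nonneg h1, abs_of_nonpos h2]; linarith
  · refine twisted_aux W hW v 0 1 2 (by decide) (by decide) dec01 ?_
    rw [hl1, hv2, abs_of_nonpos h0, abs_of_nonpos h1, abs_of_nonneg (by linarith : 0 ≤ -v 0 - v 1)]; linarith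

/-- Untwisted stage `R_r S^t Q_q`. -/
structure UStage where
  q : ZMod 3 → ℝ
  t : ZMod 3
  r : ZMod 3

/-- Twisted stage `G_{s,t} E_o`. -/
structure TStage where
  o : Option (ZMod 3)
  s : ZMod 3
  t : ZMod 3

/-- The operator of an untwisted stage. -/
noncomputable def UStage.op (S : UStage) (v : ZMod 3 → ℝ) : ZMod 3 → ℝ := reflL S.r (shiftL S.t (circL S.q v))

/-- The operator of a twisted stage. -/
noncomputable def TStage.op (S : TStage) (v : ZMod 3 → ℝ) : ZMod 3 → ℝ := gtwL S.s S.t (oreflL S.o v)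

/-- Apply a list of untwisted stages, head first. -/
noncomputable def applyU : List UStage → (ZMod 3 → ℝ) → (ZMod 3 → ℝ)
  | [], v => v
  | S :: L, v => applyU L (S.op v)

/-- Apply a list of twisted stages, head first. -/
noncomputable def applyT : List TStage → (ZMod 3 → ℝ) → (ZMod 3 → ℝ)
  | [], v => v
  | S :: L, v => applyT L (S.op v)

/-- An untwisted stage does not expand the `ℓ¹` norm. -/
theorem UStage.l1R_op_le (S : UStage) (hS : IsCoinBlock S.q) (v : ZMod 3 → ℝ) : l1R (S.op v) ≤ l1R v := by
  unfold UStage.op; rw [l1R_reflL, l1R_shiftL]; exact l1R_circL_le hS v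

/-- Three untwisted stages halve the norm (LEMMA C with shifts folded into the blocks). -/
theorem UStage.three_le (S₁ S₂ S₃ : UStage) (h₁ : IsCoinBlock S₁.q) (h₂ : IsCoinBlock S₂.q) (h₃ : IsCoinBlock S₃.q)
    (v : ZMod 3 → ℝ) : l1R (S₃.op (S₂.op (S₁.op v))) ≤ 1 / 2 * l1R v := by
  simp only [UStage.op, shiftL_circL]
  exact threePairContraction (h₁.shift S₁.t) (h₂.shift S₂.t) (h₃.shift S₃.t) S₁.r S₂.r S₃.r v

/-- **Untwisted chain bound (PROVED)**: `n` stages with coin blocks contract `ℓ¹` by `(1/2)^{⌊n/3⌋}`. -/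
theorem applyU_le : ∀ (L : List UStage), (∀ S ∈ L, IsCoinBlock S.q) → ∀ v : ZMod 3 → ℝ,
    l1R (applyU L v) ≤ (1 / 2 : ℝ) ^ (L.length / 3) * l1R v
  | [], _, v => by simp [applyU]
  | [S], hL, v => by
      simp only [applyU, List.length_singleton, Nat.reduceDiv, pow_zero, one_mul]
      exact S.l1R_op_le (hL S (by simp)) v
  | [S₁, S₂], hL, v => by
      have h0 : ([S₁, S₂] : List UStage).length / 3 = 0 := by simp
      rw [h0, pow_zero, one_mul]
      exact (S₂.l1R_op_le (hL S₂ (by simp)) _).trans (S₁.l1R_op_le (hL S₁ (by simp)) v)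
  | S₁ :: S₂ :: S₃ :: L, hL, v => by
      have ih := applyU_le L (fun S hS => hL S (by simp [hS])) (S₃.op (S₂.op (S₁.op v)))
      have h3 := UStage.three_le S₁ S₂ S₃ (hL S₁ (by simp)) (hL S₂ (by simp)) (hL S₃ (by simp)) v
      have hlen : (S₁ :: S₂ :: S₃ :: L).length / 3 = L.length / 3 + 1 := by
        simp only [List.length_cons]; omega
      simp only [applyU]
      rw [hlen, pow_succ]
      calc l1R (applyU L (S₃.op (S₂.op (S₁.op v)))) ≤ (1 / 2 : ℝ) ^ (L.length / 3) * l1R (S₃.op (S₂.op (S₁.op v))) := ih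
        _ ≤ (1 / 2 : ℝ) ^ (L.length / 3) * (1 / 2 * l1R v) := mul_le_mul_of_nonneg_left h3 (by positivity)
        _ = (1 / 2 : ℝ) ^ (L.length / 3) * (1 / 2) * l1R v := by ring

/-- The twisted-chain bound sequence: `1, 2, 3, 6, 9, 18, …` = `2^{n mod 2} 3^{⌊n/2⌋}` = `2^n (3/4)^{⌊n/2⌋}`. -/
noncomputable def twBound : ℕ → ℝ
  | 0 => 1
  | 1 => 2
  | n + 2 => 3 * twBound n

/-- Closed form of `twBound`. -/
theorem twBound_eq : ∀ n : ℕ, twBound n = (2 : ℝ) ^ n * (3 / 4 : ℝ) ^ (n / 2)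
  | 0 => by simp [twBound]
  | 1 => by simp [twBound]
  | n + 2 => by
      have h : (n + 2) / 2 = n / 2 + 1 := by omega
      rw [twBound, twBound_eq n, h, pow_succ, pow_add]; ring

/-- `twBound` is non-negative. -/
theorem twBound_nonneg (n : ℕ) : 0 ≤ twBound n := by rw [twBound_eq]; positivity

/-- A twisted stage at most doubles the `ℓ¹` norm. -/
theorem TStage.l1R_op_le (S : TStage) (v : ZMod 3 → ℝ) : l1R (S.op v) ≤ 2 * l1R v := by
  unfold TStage.op; refine (l1R_gtwL_le _ _ _).trans ?_; rw [l1R_oreflL]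

/-- A twisted stage kills the total mass. -/
theorem TStage.msum_op (S : TStage) (v : ZMod 3 → ℝ) : msum (S.op v) = 0 := msum_gtwL _ _ _

/-- Two twisted stages from a mean-zero state: factor `3` (in doubled units) — `gtwTwoCoinContraction`. -/
theorem TStage.two_le (S₁ S₂ : TStage) (h₁ : S₁.s ≠ S₁.t) (h₂ : S₂.s ≠ S₂.t) (v : ZMod 3 → ℝ) (hv : msum v = 0) :
    l1R (S₂.op (S₁.op v)) ≤ 3 * l1R v :=
  gtwTwoCoinContraction S₁.o S₂.o h₁ h₂ v hv

/-- **Twisted chain bound from a mean-zero state (PROVED)**: `‖applyT L v‖₁ ≤ twBound |L| · ‖v‖₁ = 2^{|L|}(3/4)^{⌊|L|/2⌋}‖v‖₁`. -/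
theorem applyT_le_of_msum : ∀ (L : List TStage), (∀ S ∈ L, S.s ≠ S.t) → ∀ v : ZMod 3 → ℝ, msum v = 0 →
    l1R (applyT L v) ≤ twBound L.length * l1R v
  | [], _, v, _ => by simp [applyT, twBound]
  | [S], _, v, _ => by
      simp only [applyT, List.length_singleton, twBound]
      exact S.l1R_op_le v
  | S₁ :: S₂ :: L, hL, v, hv => by
      have ih := applyT_le_of_msum L (fun S hS => hL S (by simp [hS])) (S₂.op (S₁.op v)) (S₂.msum_op _)
      have h2 := TStage.two_le S₁ S₂ (hL S₁ (by simp)) (hL S₂ (by simp)) v hv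
      simp only [applyT, List.length_cons, twBound]
      calc l1R (applyT L (S₂.op (S₁.op v))) ≤ twBound L.length * l1R (S₂.op (S₁.op v)) := ih
        _ ≤ twBound L.length * (3 * l1R v) := mul_le_mul_of_nonneg_left h2 (twBound_nonneg _)
        _ = 3 * twBound L.length * l1R v := by ring

/-- **Twisted chain bound (PROVED)**: for `Z ≥ 1` twisted stages and ANY start, `‖applyT L v‖₁ ≤ 2·twBound(Z−1)·‖v‖₁ = 2^Z (3/4)^{⌊(Z−1)/2⌋}‖v‖₁`
(the first coin makes the state mean-zero, then pairs contract). -/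
theorem applyT_le (S : TStage) (L : List TStage) (hL : ∀ S' ∈ L, S'.s ≠ S'.t) (v : ZMod 3 → ℝ) :
    l1R (applyT (S :: L) v) ≤ 2 * twBound L.length * l1R v := by
  simp only [applyT]
  calc l1R (applyT L (S.op v)) ≤ twBound L.length * l1R (S.op v) := applyT_le_of_msum L hL _ (S.msum_op v)
    _ ≤ twBound L.length * (2 * l1R v) := mul_le_mul_of_nonneg_left (S.l1R_op_le v) (twBound_nonneg _)
    _ = 2 * twBound L.length * l1R v := by ring

end AffBells33

end Summit.QuantumAdvantage.AdviceFreeQNC0
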